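import Literature.Analysis.FluidPDE.StokesInteriorEstimateProofs
import Literature.Analysis.FluidPDE.HessianLaplacianLpProofs
import HarnessLib

/-!
# Interior `L^r` estimates for the Stokes system on balls: the discharge

Analysis/FluidPDE proof file for the named fact
`Literature.Analysis.FluidPDE.stokes_interior_Lr_estimate` (`FluidPDE/StokesInteriorEstimate`;
T.-P. Tsai, *On Leray's self-similar solutions of the Navier–Stokes equations satisfying local
energy estimates*, Arch. Rational Mech. Anal. 143 (1998), §3.2 display (3.2) p. 37, from
Galdi, Vol. I, p. 208 = Cattabriga 1961):

* `stokes_interior_Lr_estimate_holds : stokes_interior_Lr_estimate` — **the discharge**.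

It is the composition of the reduction
`stokes_interior_Lr_estimate_of_hessian : stein1970_hessian_Lp_bound ℝ³ → stokes_interior_Lr_estimate`
(`FluidPDE/StokesInteriorEstimateProofs`: cut-off localisation of the whole-space a priori
estimate `FluidPDE/StokesWholeSpaceEstimate`, itself the pressure estimate
`FluidPDE/StokesWholeSpacePressure` plus Stein's Proposition 3 for vector fields
`FluidPDE/HessianLpVector`) with the discharge of Stein's Proposition 3 on `ℝ³`,
`stein1970_hessian_Lp_bound_holds_fin3` (`FluidPDE/HessianLaplacianLpProofs`, from the
Calderón–Zygmund `L^p` theory of `Literature/Analysis/SingularIntegrals/`). The trust base is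
Mathlib's axioms only.

## References

* T.-P. Tsai, Arch. Rational Mech. Anal. 143 (1998) 29–51, §3.2 (3.2) p. 37 [Tsai1998].
* E. M. Stein, *Singular integrals and differentiability properties of functions* (1970),
  Ch. III §1.3 Prop. 3; Ch. II §3.2 Thm 2 [Stein1971].
* G. P. Galdi, *An introduction to the mathematical theory of the Navier–Stokes equations*,
  Vol. I (1994) p. 208; 2nd ed. (2011), Ch. IV §IV.2, §IV.4 [Galdi2011].
-/

noncomputable section

namespace Literature.Analysis.FluidPDE

/-- **Discharge of `stokes_interior_Lr_estimate`** (Tsai 1998, (3.2) p. 37; Galdi, Vol. I,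
p. 208; Cattabriga 1961): the interior `L^r` estimate for the Stokes system on concentric balls,
`‖∇²v‖_{r,B_R} + ‖∇π‖_{r,B_R} ≤ C(ν,r,R)(‖f‖_{r,B_{2R}} + ‖v‖_{1,r,B_{2R}−B_R} + ‖π‖_{r,B_{2R}−B_R})`,
`1 < r < ∞`, for classical pairs `v ∈ C²(ℝ³; ℝ³)`, `π ∈ C¹(ℝ³)` with `div v = 0` on `B_{2R}(x₀)`
and `f := νΔv − ∇π`. PROVED (`stokes_interior_Lr_estimate_of_hessian` and
`stein1970_hessian_Lp_bound_holds_fin3`). [cite: Tsai1998, §3.2 (3.2) p. 37] -/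
theorem stokes_interior_Lr_estimate_holds : stokes_interior_Lr_estimate :=
  stokes_interior_Lr_estimate_of_hessian stein1970_hessian_Lp_bound_holds_fin3

end Literature.Analysis.FluidPDE

end
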